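import Literature.AlgebraicGeometry.Frobenioids.QuasiTemperoidConnected
import Mathlib.Tactic.Group
import HarnessLib

/-!
# Frobenioids II, Example 1.3 (ii): the functor `φ_*` for a general open homomorphism (induction)

Mochizuki, *The geometry of Frobenioids II*, Kyushu J. Math. **62** (2008) 401–460, §1 Example 1.3
(i)–(ii), author's text p. 11 [cite: MochizukiFrdII2008, Ex 1.3 (ii) p.11]. For an open homomorphism
`φ : Π₁ → Π₂` of tempered groups the text defines `φ_* : B^temp(Π₁)⁰ → B^temp(Π₂)⁰` "by composing the
functor `B^temp(φ(Π₁))⁰ → B^temp(Π₂)⁰` of (i)" [induction from the open subgroup `φ(Π₁)`, via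
"`B^temp(Π°) ≃ B^temp(Π)_{Π/Π°}`"] "with the functor `B^temp(Π₁)⁰ → B^temp(φ(Π₁))⁰` obtained by mapping a
`Π₁`-set `E` to the `φ(Π₁)`-set `E' := E/Ker(φ)`". Both steps are instances of ONE construction, the
induced `Π₂`-set `Π₂ ×^{Π₁} E := (Π₂ × E)/Π₁` (`g · (q, x) = (q φ(g)⁻¹, g x)`, `Π₂` acting on the left
factor), which this file constructs for an arbitrary homomorphism `φ : Π₁ → Π₂` of topological groups that
is an OPEN MAP, into `B^temp(Π₂)` whenever the open subgroups of `Π₂` have countable index (true for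
tempered `Π₂`, [SemiAnbd] Rmk 3.1.2, and for quotients of profinite groups — Ex. 1.3 (iii)):

* `inducedRel`, `InducedSet φ X`, `inducedMk q x = [(q, x)]`, `inducedMk_mul : [(q φ(g), x)] = [(q, g x)]`;
* `inducedMulAction`, `inducedObj` — `Π₂ ×^{Π₁} E ∈ Ob(B^temp(Π₂))`: countable (it is covered by the countable
  sets `Π₂/φ(Stab x)`, `x ∈ E`), with `Stab [(q, x)] = q φ(Stab x) q⁻¹` open since `φ` is open;
* `inductionFunctor φ … : BTemp Π₁ ⥤ BTemp Π₂` and `inductionFunctor_isConnectedObj` (single orbits go to single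
  orbits), `inductionFunctorConnected : B^temp(Π₁)⁰ ⥤ B^temp(Π₂)⁰` — the functor `φ_*` of the text;
* `inductionFunctorHomEquiv` / `inductionFunctorAdjunction : inductionFunctor φ ⊣ BTemp.res φ` (Frobenius reciprocity), which
  pins the construction down up to isomorphism.

Used by `QuasiTemperoidGaloisBase.lean` for the middle arrow of the functor of Ex. 1.3 (iii). The
surjective case `E/Ker(φ)` with its own adjunction is `QuasiTemperoidPushforward.lean`; the printed
equivalence `B^temp(Π°) ≃ B^temp(Π)_{Π/Π°}` itself (named fact `InductionEquivalence`) is discharged in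
`QuasiTemperoidInduction.lean` (seat abc-iut-L6-t8). No statement of the paper is strengthened.
-/

open CategoryTheory CategoryTheory.Limits Topology
open Literature.AnabelianGeometry.SemiGraphs

namespace Literature.AlgebraicGeometry.Frobenioids

namespace QuasiTemperoid

universe u

variable {G : Type u} [Group G] [TopologicalSpace G] {Q : Type u} [Group Q]

/-! ### Stabilisers in `B^temp(Π)` -/

/-- The stabiliser `Stab(x) ⊆ Π` of a point of an object of `B^temp(Π)`, as a subgroup.
[cite: MochizukiFrdII2008, Ex 1.3 (ii) p.11] -/
def stabilizerSubgroup (X : BTemp G) (x : X.obj.V) : Subgroup G where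
  carrier := {g : G | X.obj.ρ g x = x}
  one_mem' := BTempConnected.ρ_one_apply X x
  mul_mem' {a b} ha hb := by
    change X.obj.ρ (a * b) x = x
    rw [BTempConnected.ρ_mul_apply, hb, ha]
  inv_mem' {a} ha := by
    change X.obj.ρ a⁻¹ x = x
    conv_lhs => rw [← ha]
    exact BTempConnected.ρ_inv_apply X a x

/-- Membership in the stabiliser. [cite: MochizukiFrdII2008, Ex 1.3 (ii) p.11] -/
theorem mem_stabilizerSubgroup_iff {X : BTemp G} {x : X.obj.V} {g : G} : g ∈ stabilizerSubgroup X x ↔ X.obj.ρ g x = x :=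
  Iff.rfl

/-- Stabilisers of points of objects of `B^temp(Π)` are open (the defining condition of `B^temp(Π)`).
[cite: MochizukiFrdII2008, Ex 1.3 (ii) p.11] -/
theorem isOpen_stabilizerSubgroup (X : BTemp G) (x : X.obj.V) : IsOpen (stabilizerSubgroup X x : Set G) :=
  X.property.2 x

/-! ### The induced set `Π₂ ×^{Π₁} E` -/

section InducedSet

variable (φ : G →* Q)

/-- The relation on `Π₂ × E` generated by `(q, x) ~ (q φ(g)⁻¹, g x)`, `g ∈ Π₁` (an equivalence relation).
[cite: MochizukiFrdII2008, Ex 1.3 (ii) p.11] -/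
def inducedRel (X : BTemp G) : Setoid (Q × X.obj.V) where
  r p p' := ∃ g : G, p'.1 = p.1 * (φ g)⁻¹ ∧ p'.2 = X.obj.ρ g p.2
  iseqv :=
    { refl := fun p => ⟨1, by rw [map_one, inv_one, mul_one], (BTempConnected.ρ_one_apply X p.2).symm⟩
      symm := fun {p p'} ⟨g, h1, h2⟩ => ⟨g⁻¹, by
          rw [h1, map_inv, inv_inv, inv_mul_cancel_right], by
          rw [h2, BTempConnected.ρ_inv_apply]⟩
      trans := fun {p p' p''} ⟨g, h1, h2⟩ ⟨g', h1', h2'⟩ => ⟨g' * g, by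
          rw [h1', h1, map_mul, mul_inv_rev, mul_assoc], by
          rw [h2', h2, BTempConnected.ρ_mul_apply]⟩ }

/-- The induced `Π₂`-set `Π₂ ×^{Π₁} E := (Π₂ × E)/Π₁` underlying `φ_*(X)` (FrdII Ex. 1.3 (i)–(ii), p. 11:
for `φ` the inclusion of an open subgroup this is the induction `B^temp(Π°) → B^temp(Π)`, for `φ`
surjective it is `E/Ker(φ)`). [cite: MochizukiFrdII2008, Ex 1.3 (ii) p.11] -/
def InducedSet (X : BTemp G) : Type u := Quotient (inducedRel φ X)

variable {φ}

/-- The relation, unfolded. [cite: MochizukiFrdII2008, Ex 1.3 (ii) p.11] -/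
theorem inducedRel_iff {X : BTemp G} {p p' : Q × X.obj.V} :
    (inducedRel φ X) p p' ↔ ∃ g : G, p'.1 = p.1 * (φ g)⁻¹ ∧ p'.2 = X.obj.ρ g p.2 :=
  Iff.rfl

/-- The class `[(q, x)] ∈ Π₂ ×^{Π₁} E`. [cite: MochizukiFrdII2008, Ex 1.3 (ii) p.11] -/
def inducedMk {X : BTemp G} (q : Q) (x : X.obj.V) : InducedSet φ X := Quotient.mk (inducedRel φ X) (q, x)

/-- Equality of classes. [cite: MochizukiFrdII2008, Ex 1.3 (ii) p.11] -/
theorem inducedMk_eq_iff {X : BTemp G} {q q' : Q} {x x' : X.obj.V} :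
    (inducedMk q x : InducedSet φ X) = inducedMk q' x' ↔ ∃ g : G, q' = q * (φ g)⁻¹ ∧ x' = X.obj.ρ g x :=
  Quotient.eq

/-- Induction on `Π₂ ×^{Π₁} E`: it suffices to treat classes `[(q, x)]`. [cite: MochizukiFrdII2008, Ex 1.3 (ii) p.11] -/
theorem inducedSet_ind {X : BTemp G} {p : InducedSet φ X → Prop} (h : ∀ q x, p (inducedMk q x)) (c : InducedSet φ X) :
    p c :=
  Quotient.ind (fun z => h z.1 z.2) c

/-- The defining identification `[(q φ(g), x)] = [(q, g x)]`. [cite: MochizukiFrdII2008, Ex 1.3 (ii) p.11] -/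
theorem inducedMk_mul {X : BTemp G} (q : Q) (g : G) (x : X.obj.V) :
    (inducedMk (q * φ g) x : InducedSet φ X) = inducedMk q (X.obj.ρ g x) :=
  inducedMk_eq_iff.2 ⟨g, by rw [mul_inv_cancel_right], rfl⟩

variable (φ)

/-- The `Π₂`-action on `Π₂ ×^{Π₁} E`: `q'' · [(q, x)] = [(q'' q, x)]`. [cite: MochizukiFrdII2008, Ex 1.3 (ii) p.11] -/
@[reducible] def inducedMulAction (X : BTemp G) : MulAction Q (InducedSet φ X) where
  smul q'' := Quotient.map' (fun p => (q'' * p.1, p.2)) fun p p' hpp' => by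
    obtain ⟨g, h1, h2⟩ := inducedRel_iff.1 hpp'
    exact inducedRel_iff.2 ⟨g, by rw [h1, mul_assoc], h2⟩
  one_smul c := by
    induction c using Quotient.ind with
    | _ p =>
      change Quotient.mk _ (1 * p.1, p.2) = Quotient.mk _ p
      rw [one_mul]
  mul_smul a b c := by
    induction c using Quotient.ind with
    | _ p =>
      change Quotient.mk _ (a * b * p.1, p.2) = Quotient.mk _ (a * (b * p.1), p.2)
      rw [mul_assoc]

/-- The action on classes. [cite: MochizukiFrdII2008, Ex 1.3 (ii) p.11] -/
theorem induced_smul_mk (X : BTemp G) (q'' q : Q) (x : X.obj.V) :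
    (letI := inducedMulAction φ X; q'' • (inducedMk q x : InducedSet φ X)) = inducedMk (q'' * q) x :=
  rfl

/-- A `Π₁`-map `E → F` induces `Π₂ ×^{Π₁} E → Π₂ ×^{Π₁} F`. [cite: MochizukiFrdII2008, Ex 1.3 (ii) p.11] -/
def inducedMap {X Y : BTemp G} (f : X ⟶ Y) : InducedSet φ X → InducedSet φ Y :=
  Quotient.map' (fun p => (p.1, (f.hom.hom p.2 : Y.obj.V))) fun p p' hpp' => by
    obtain ⟨g, h1, h2⟩ := inducedRel_iff.1 hpp'
    exact inducedRel_iff.2 ⟨g, h1, by rw [h2, BTempConnected.hom_ρ]⟩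

/-- The induced map on classes: `[(q, x)] ↦ [(q, f x)]`. [cite: MochizukiFrdII2008, Ex 1.3 (ii) p.11] -/
theorem inducedMap_mk {X Y : BTemp G} (f : X ⟶ Y) (q : Q) (x : X.obj.V) :
    inducedMap φ f (inducedMk q x) = (inducedMk q (f.hom.hom x) : InducedSet φ Y) :=
  rfl

/-- `Π₂ ×^{Π₁} E` is countable as soon as the subgroups `φ(Stab x)` have countable index in `Π₂`: it is the
union over `x ∈ E` (countable) of the images `{[(q, x)] : q} ≅ Π₂/φ(Stab x)`.
[cite: MochizukiFrdII2008, Ex 1.3 (ii) p.11] -/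
theorem countable_inducedSet (X : BTemp G) (hQ : ∀ x : X.obj.V, Countable (Q ⧸ (stabilizerSubgroup X x).map φ)) :
    Countable (InducedSet φ X) := by
  haveI : Countable X.obj.V := X.property.1
  haveI := hQ
  -- the covering map from `Σ x, Π₂/φ(Stab x)`
  let f : (Σ x : X.obj.V, Q ⧸ (stabilizerSubgroup X x).map φ) → InducedSet φ X := fun z =>
    Quotient.liftOn' z.2 (fun q => inducedMk q z.1) fun a b hab => by
      rw [QuotientGroup.leftRel_apply, Subgroup.mem_map] at hab
      obtain ⟨g, hg, hφg⟩ := hab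
      have hb : b = a * φ g := by rw [hφg, mul_inv_cancel_left]
      rw [hb, inducedMk_mul, mem_stabilizerSubgroup_iff.1 hg]
  refine Function.Surjective.countable (f := f) fun c => ?_
  induction c using Quotient.ind with
  | _ p => exact ⟨⟨p.2, (p.1 : Q ⧸ (stabilizerSubgroup X p.2).map φ)⟩, rfl⟩

/-- The stabiliser of `[(q, x)]` in `Π₂` is `q φ(Stab x) q⁻¹`, open when `φ` is an open map.
[cite: MochizukiFrdII2008, Ex 1.3 (ii) p.11] -/
theorem isOpen_stabilizer_inducedMk [TopologicalSpace Q] [IsTopologicalGroup Q] (hφ : IsOpenMap φ)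
    (X : BTemp G) (q : Q) (x : X.obj.V) :
    IsOpen {q'' : Q | (inducedMk (q'' * q) x : InducedSet φ X) = inducedMk q x} := by
  have : {q'' : Q | (inducedMk (q'' * q) x : InducedSet φ X) = inducedMk q x} =
      (fun q'' => q⁻¹ * q'' * q) ⁻¹' (φ '' (stabilizerSubgroup X x : Set G)) := by
    ext q''
    simp only [Set.mem_setOf_eq, Set.mem_preimage, Set.mem_image, SetLike.mem_coe, mem_stabilizerSubgroup_iff,
      inducedMk_eq_iff]
    constructor
    · rintro ⟨g, h1, h2⟩
      refine ⟨g, h2.symm, ?_⟩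
      have h' : q * φ g = q'' * q := by
        calc q * φ g = q'' * q * (φ g)⁻¹ * φ g := by rw [← h1]
          _ = q'' * q := by rw [inv_mul_cancel_right]
      rw [mul_assoc, ← h', ← mul_assoc, inv_mul_cancel, one_mul]
    · rintro ⟨g, hg, hφg⟩
      refine ⟨g, ?_, hg.symm⟩
      rw [hφg]
      group
  rw [this]
  exact (hφ _ (isOpen_stabilizerSubgroup X x)).preimage (by fun_prop)

end InducedSet

/-! ### Extension of `Π₁`-maps to the induced set -/

section Lift

variable [TopologicalSpace Q] (φ : G →* Q) (hc : Continuous φ)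

/-- A `Π₁`-map `E → F|_{Π₁}` extends uniquely to a `Π₂`-map `Π₂ ×^{Π₁} E → F`, `[(q, x)] ↦ q · v(x)`.
[cite: MochizukiFrdII2008, Ex 1.3 (ii) p.11] -/
def inducedLift {X : BTemp G} {Y : BTemp Q} (v : X ⟶ (BTemp.res ⟨φ, hc⟩).obj Y) : InducedSet φ X → Y.obj.V :=
  Quotient.lift (fun p => Y.obj.ρ p.1 (v.hom.hom p.2 : Y.obj.V)) fun p p' hpp' => by
    obtain ⟨g, h1, h2⟩ := inducedRel_iff.1 hpp'
    have e := BTempConnected.hom_ρ v g p.2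
    change (v.hom.hom (X.obj.ρ g p.2) : Y.obj.V) = Y.obj.ρ (φ g) (v.hom.hom p.2) at e
    change Y.obj.ρ p.1 (v.hom.hom p.2) = Y.obj.ρ p'.1 (v.hom.hom p'.2)
    rw [h1, h2, e, ← BTempConnected.ρ_mul_apply, inv_mul_cancel_right]

/-- The extension on classes. [cite: MochizukiFrdII2008, Ex 1.3 (ii) p.11] -/
theorem inducedLift_mk {X : BTemp G} {Y : BTemp Q} (v : X ⟶ (BTemp.res ⟨φ, hc⟩).obj Y) (q : Q) (x : X.obj.V) :
    inducedLift φ hc v (inducedMk q x) = Y.obj.ρ q (v.hom.hom x : Y.obj.V) :=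
  rfl

end Lift

/-! ### The functor `inductionFunctor φ : B^temp(Π₁) ⥤ B^temp(Π₂)` -/

section Functor

variable [TopologicalSpace Q] [IsTopologicalGroup Q] (φ : G →* Q) (hφ : IsOpenMap φ)
  (hQ : ∀ U : Subgroup Q, IsOpen (U : Set Q) → Countable (Q ⧸ U))

/-- `φ_*(X) = Π₂ ×^{Π₁} E ∈ Ob(B^temp(Π₂))` for an open map `φ` into a group whose open subgroups have
countable index (FrdII Ex. 1.3 (i)–(ii), p. 11). [cite: MochizukiFrdII2008, Ex 1.3 (ii) p.11] -/
def inducedObj (X : BTemp G) : BTemp Q :=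
  ⟨@Action.ofMulAction Q (InducedSet φ X) _ (inducedMulAction φ X), by
    letI := inducedMulAction φ X
    refine ⟨countable_inducedSet φ X fun x => hQ _ ?_, fun c => ?_⟩
    · rw [Subgroup.coe_map]
      exact hφ _ (isOpen_stabilizerSubgroup X x)
    · induction c using Quotient.ind with
      | _ p =>
        change IsOpen {q'' : Q | q'' • (inducedMk p.1 p.2 : InducedSet φ X) = inducedMk p.1 p.2}
        exact isOpen_stabilizer_inducedMk φ hφ X p.1 p.2⟩

/-- The action of `φ_*(X)` on classes: `q'' · [(q, x)] = [(q'' q, x)]`. [cite: MochizukiFrdII2008, Ex 1.3 (ii) p.11] -/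
theorem inducedObj_ρ_mk (X : BTemp G) (q'' q : Q) (x : X.obj.V) :
    (inducedObj φ hφ hQ X).obj.ρ q'' (inducedMk q x) = (inducedMk (q'' * q) x : InducedSet φ X) :=
  rfl

/-- **Example 1.3 (ii)** (FrdII p. 11), general form: the induction functor `B^temp(Π₁) → B^temp(Π₂)`,
`E ↦ Π₂ ×^{Π₁} E`, along an open map `φ : Π₁ → Π₂`. [cite: MochizukiFrdII2008, Ex 1.3 (ii) p.11] -/
def inductionFunctor : BTemp G ⥤ BTemp Q where
  obj X := inducedObj φ hφ hQ X
  map {X Y} f := ObjectProperty.homMk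
    { hom := TypeCat.ofHom (inducedMap φ f)
      comm := fun q'' => by
        apply ConcreteCategory.hom_ext
        intro c
        induction c using Quotient.ind with
        | _ p => rfl }
  map_id X := by
    apply BTempConnected.hom_ext_apply
    intro c
    induction c using Quotient.ind with
    | _ p => rfl
  map_comp f g := by
    apply BTempConnected.hom_ext_apply
    intro c
    induction c using Quotient.ind with
    | _ p => rfl

/-- The induction functor on classes: `φ_*(f)[(q, x)] = [(q, f x)]`. [cite: MochizukiFrdII2008, Ex 1.3 (ii) p.11] -/
theorem inductionFunctor_map_mk {X Y : BTemp G} (f : X ⟶ Y) (q : Q) (x : X.obj.V) :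
    (((inductionFunctor φ hφ hQ).map f).hom.hom (inducedMk q x) : InducedSet φ Y) = inducedMk q (f.hom.hom x) :=
  rfl

/-- `φ_*` carries single orbits to single orbits, i.e. preserves connected objects, so it restricts to
`B^temp(Π₁)⁰ → B^temp(Π₂)⁰` (FrdII Ex. 1.3 (ii), p. 11). [cite: MochizukiFrdII2008, Ex 1.3 (ii) p.11] -/
theorem inductionFunctor_isConnectedObj (X : BTemp G) (hX : IsConnectedObj X) :
    IsConnectedObj ((inductionFunctor φ hφ hQ).obj X) := by
  obtain ⟨x₀⟩ := BTempConnected.nonempty_of_isConnectedObj X hX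
  refine BTempConnected.isConnectedObj_of_transitive _ (inducedMk 1 x₀ : InducedSet φ X) fun c => ?_
  induction c using Quotient.ind with
  | _ p =>
    obtain ⟨g, hg⟩ := BTempConnected.exists_ρ_eq_of_isConnectedObj X hX x₀ p.2
    refine ⟨p.1 * φ g, ?_⟩
    change (inducedObj φ hφ hQ X).obj.ρ (p.1 * φ g) (inducedMk 1 x₀) = inducedMk p.1 p.2
    rw [inducedObj_ρ_mk, mul_one, inducedMk_mul, hg]

/-- **Example 1.3 (ii)** (FrdII p. 11): `φ_* : B^temp(Π₁)⁰ → B^temp(Π₂)⁰` for an open map `φ`, as the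
restriction of `inductionFunctor φ` to connected objects. [cite: MochizukiFrdII2008, Ex 1.3 (ii) p.11] -/
def inductionFunctorConnected : ConnectedPart (BTemp G) ⥤ ConnectedPart (BTemp Q) :=
  (connectedObjects (BTemp Q)).lift ((connectedObjects (BTemp G)).ι ⋙ inductionFunctor φ hφ hQ)
    fun T => inductionFunctor_isConnectedObj φ hφ hQ T.obj T.property

/-! ### Frobenius reciprocity: `inductionFunctor φ ⊣ BTemp.res φ` -/

variable (hc : Continuous φ)

/-- Frobenius reciprocity `Hom_{Π₂}(Π₂ ×^{Π₁} E, F) ≃ Hom_{Π₁}(E, F|_{Π₁})`: restrict along `x ↦ [(1, x)]`,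
extend by `[(q, x)] ↦ q · v(x)`. [cite: MochizukiFrdII2008, Ex 1.3 (ii) p.11] -/
def inductionFunctorHomEquiv (X : BTemp G) (Y : BTemp Q) :
    ((inductionFunctor φ hφ hQ).obj X ⟶ Y) ≃ (X ⟶ (BTemp.res ⟨φ, hc⟩).obj Y) where
  toFun u := ObjectProperty.homMk
    { hom := TypeCat.ofHom fun x => (u.hom.hom (inducedMk 1 x) : Y.obj.V)
      comm := fun g => by
        apply ConcreteCategory.hom_ext
        intro x
        change (u.hom.hom (inducedMk 1 (X.obj.ρ g x)) : Y.obj.V) = Y.obj.ρ (φ g) (u.hom.hom (inducedMk 1 x))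
        have h1 : (inducedMk 1 (X.obj.ρ g x) : InducedSet φ X) = (inducedObj φ hφ hQ X).obj.ρ (φ g) (inducedMk 1 x) := by
          rw [inducedObj_ρ_mk, mul_one, ← inducedMk_mul, one_mul]
        rw [h1]
        exact BTempConnected.hom_ρ u (φ g) (inducedMk 1 x) }
  invFun v := ObjectProperty.homMk
    { hom := TypeCat.ofHom (inducedLift φ hc v)
      comm := fun q'' => by
        apply ConcreteCategory.hom_ext
        intro c
        induction c using Quotient.ind with
        | _ p =>
          change inducedLift φ hc v ((inducedObj φ hφ hQ X).obj.ρ q'' (inducedMk p.1 p.2)) =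
            Y.obj.ρ q'' (inducedLift φ hc v (inducedMk p.1 p.2))
          rw [inducedObj_ρ_mk, inducedLift_mk, inducedLift_mk, BTempConnected.ρ_mul_apply] }
  left_inv u := by
    apply BTempConnected.hom_ext_apply
    intro c
    induction c using Quotient.ind with
    | _ p =>
      change Y.obj.ρ p.1 (u.hom.hom (inducedMk 1 p.2)) = u.hom.hom (inducedMk p.1 p.2)
      rw [← BTempConnected.hom_ρ u]
      change (u.hom.hom ((inducedObj φ hφ hQ X).obj.ρ p.1 (inducedMk 1 p.2)) : Y.obj.V) = _
      rw [inducedObj_ρ_mk, mul_one]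
  right_inv v := by
    apply BTempConnected.hom_ext_apply
    intro x
    change Y.obj.ρ 1 (v.hom.hom x) = v.hom.hom x
    rw [BTempConnected.ρ_one_apply]

/-- **Frobenius reciprocity** for `B^temp`: induction along `φ` is left adjoint to pull-back along `φ`
(`inductionFunctor φ ⊣ BTemp.res φ`); for surjective `φ` this is the printed "`φ_*` is left adjoint to the
pull-back functor" of FrdII Ex. 1.3 (ii), p. 11. [cite: MochizukiFrdII2008, Ex 1.3 (ii) p.11] -/
def inductionFunctorAdjunction : inductionFunctor φ hφ hQ ⊣ BTemp.res ⟨φ, hc⟩ :=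
  Adjunction.mkOfHomEquiv
    { homEquiv := fun X Y => inductionFunctorHomEquiv φ hφ hQ hc X Y
      homEquiv_naturality_left_symm := fun {X' X Y} f g => by
        apply BTempConnected.hom_ext_apply
        intro c
        induction c using Quotient.ind with
        | _ p => rfl
      homEquiv_naturality_right := fun {X Y Y'} f g => by
        apply BTempConnected.hom_ext_apply
        intro x
        rfl }

end Functor

end QuasiTemperoid

end Literature.AlgebraicGeometry.Frobenioids
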